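import Summits.ResolutionOfSingularities.ResolutionOfSingularities.Theorems.PAlterationPicoverBaseCase
import Summits.ResolutionOfSingularities.ResolutionOfSingularities.Theorems.PAlterationPicoverFunctionFieldRadicial
import Summits.ResolutionOfSingularities.ResolutionOfSingularities.Theorems.PAlterationPicoverFunctionFieldNormalizationIn
import Literature.AlgebraicGeometry.Resolution.NormalizationInNormal
import Literature.AlgebraicGeometry.Resolution.QuasiProjectiveResolution
import Literature.AlgebraicGeometry.Resolution.AlterationsRationalMapExtensionProofs
import Mathlib.AlgebraicGeometry.ZariskisMainTheorem

/-!
# Crux `Picover`, line `degree-p-tower`: the tower transport step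

Route `ResolutionOfSingularities/pAlteration`, crux `Picover` (stmt-ResolutionOfSingularities-0554),
stub `stub_towerTransport` of the lead skeleton `Lines/degree-p-tower.lean`, PROVED here (statement verbatim
from the ledger registration).

**Statement.** Fix a prime `p` and a field `k` of characteristic `p`. Assume (hypothesis 1) the
function-field identification `K(W^L) ≅ L` over `K(W)` for normalizations in finite extensions,
and (hypothesis 2) the degree-`p` residue at `(p, k)`: for `W'` regular integral separated of
finite type over `k` and `L/K(W')` purely inseparable of degree `p`, `W'^L` has a resolution. Let
`W` be an integral separated `k`-scheme of finite type, `L/K(W)` finite, `M ⊆ L` an intermediate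
field with `L/M` purely inseparable of degree `p`, and suppose `W^M` has a resolution. Then `W^L`
has a resolution.

**Proof.** Let `ρ : W' → W^M` be a resolution; `W'` is integral and `K(W') ≅ M` over `K(W)`
(birational maps induce isomorphisms of function fields; hypothesis 1 for `(W, M)`), so `L` is a
`K(W')`-algebra, purely inseparable of degree `p`, and `W'` is regular, integral, separated of
finite type over `k`; hypothesis 2 gives a resolution of `W'^L`. The comparison map
`φ : W'^L → W^L` — the universal property of the relative normalization `W'^L` of `W'` in `Spec L`
applied to the factorization `Spec L → W^L ×_W W' → W'` — is proper (finite followed by a base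
change of the proper `W' → W`) and birational: its fibre over the generic point is the generic
point (generic fibres of integral morphisms, and of `ρ` over its isomorphism locus, are single
points), so by Stacks 02UP it is finite over an open neighbourhood `V` of the generic point; it is
an isomorphism on function fields (both are `L` over `K(W)`, and a `K(W)`-endomorphism of `L` is
bijective); and `W^L` is normal; hence `φ` is an isomorphism over `V`
(`isIso_morphismRestrict_of_isIntegralHom_of_normal`). Transport the resolution along `φ`.
-/

noncomputable section

set_option linter.dupNamespace false -- mandated namespace of this single-conjunct summit

open CategoryTheory CategoryTheory.Limits AlgebraicGeometry TopologicalSpace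
open Literature.AlgebraicGeometry.Resolution Literature.AlgebraicGeometry.Motives
open Summit.ResolutionOfSingularities.ResolutionOfSingularities.Theorems.Picover

namespace Summit.ResolutionOfSingularities.ResolutionOfSingularities.Theorems.Picover.TowerTransport

/-! ## Function fields along dominant morphisms -/

section FunctionFields

variable {X' X : Scheme.{0}} [IsIntegral X'] [IsIntegral X] (f : X' ⟶ X) [IsDominant f]

/-- If the stalk map of `f` at the generic point is an isomorphism then `f^♯` is bijective.
[folklore] -/
theorem bijective_functionFieldMap_of_isIso (h : IsIso (f.stalkMap (genericPoint X'))) :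
    Function.Bijective (RatFn.functionFieldMap f) := by
  haveI := FunctionFieldRadicial.isIso_stalkSpecializes_genericPoint f
  haveI := h
  exact ConcreteCategory.bijective_of_isIso
    (X.presheaf.stalkSpecializes (RatFn.specializes_genericPoint f) ≫ f.stalkMap (genericPoint X'))

end FunctionFields

/-- **A `K`-algebra endomorphism of a finite extension `L/K` is bijective**; phrased for a ring
endomorphism `ψ` of `L` fixing `K`. [folklore] -/
theorem bijective_of_comp_algebraMap_eq {K L : Type*} [Field K] [Field L] [Algebra K L]
    [FiniteDimensional K L] (ψ : L →+* L) (h : ψ.comp (algebraMap K L) = algebraMap K L) :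
    Function.Bijective ψ := by
  let ψ' : L →ₐ[K] L := { ψ with commutes' := fun c => RingHom.congr_fun h c }
  exact Algebra.IsAlgebraic.algHom_bijective ψ'

/-! ## Generic fibres -/

/-- **An integral morphism of integral schemes maps only the generic point to the generic
point** (on an affine chart `V ∋ η_X`: `Γ(Y, f⁻¹V)` is integral over `Γ(X, V)` and the prime of
`y` lies over `(0)`, hence is `(0)` — Mathlib `Ideal.eq_bot_of_comap_eq_bot`).
-- adapted from Literature/AlgebraicGeometry/Motives/AbelianVarietyChartDivisor.lean
[folklore] -/
theorem eq_genericPoint_of_isIntegralHom {X Y : Scheme.{0}} [IsIntegral X] [IsIntegral Y]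
    (f : Y ⟶ X) [IsIntegralHom f] {y : Y} (hy : f y = genericPoint X) : y = genericPoint Y := by
  obtain ⟨V', hV', hyV', -⟩ := exists_isAffineOpen_mem_and_subset
    (show f y ∈ (⊤ : X.Opens) from trivial)
  have hV : IsAffineOpen V' := hV'
  have hint₀ := (HasAffineProperty.eq_targetAffineLocally (P := @IsIntegralHom)).le f inferInstance
  have hint : targetAffineLocally (affineAnd RingHom.IsIntegral) f := hint₀
  rw [targetAffineLocally_affineAnd_iff RingHom.isIntegral_respectsIso] at hint
  obtain ⟨hW, hI⟩ := hint V' hV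
  haveI : Nonempty (f ⁻¹ᵁ V' : Y.Opens) := ⟨⟨y, hyV'⟩⟩
  haveI : Nonempty (V' : X.Opens) := ⟨⟨_, hyV'⟩⟩
  letI : Algebra Γ(X, V') Γ(Y, f ⁻¹ᵁ V') := (f.app V').hom.toAlgebra
  haveI : Algebra.IsIntegral Γ(X, V') Γ(Y, f ⁻¹ᵁ V') := ⟨hI⟩
  have hcomap : (hW.primeIdealOf ⟨y, hyV'⟩).asIdeal.comap
      (algebraMap Γ(X, V') Γ(Y, f ⁻¹ᵁ V')) = ⊥ := by
    have h1 := IsAffineOpen.comap_primeIdealOf_appLE V' hV (f ⁻¹ᵁ V') hW le_rfl hyV'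
    rw [← Scheme.Hom.app_eq_appLE] at h1
    have h2 : hV.primeIdealOf ⟨f y, hyV'⟩ = ⊥ := by
      have h3 := hV.primeIdealOf_genericPoint
      rw [genericPoint_eq_bot_of_affine] at h3
      convert h3
    have := congrArg PrimeSpectrum.asIdeal (h1.trans h2)
    exact this
  have hbot : (hW.primeIdealOf ⟨y, hyV'⟩).asIdeal = ⊥ := Ideal.eq_bot_of_comap_eq_bot hcomap
  have h4 := hW.primeIdealOf_genericPoint
  rw [genericPoint_eq_bot_of_affine] at h4
  have h5 : hW.primeIdealOf ⟨y, hyV'⟩ = hW.primeIdealOf ⟨genericPoint Y, _⟩ :=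
    (PrimeSpectrum.ext hbot).trans h4.symm
  have := congrArg hW.fromSpec h5
  rwa [hW.fromSpec_primeIdealOf, hW.fromSpec_primeIdealOf] at this

/-- **The fibre of a morphism over a point of an open over which it is an isomorphism is a
single point.** [folklore] -/
theorem subsingleton_preimage_of_isIso_morphismRestrict {T Y : Scheme.{0}} (g : T ⟶ Y)
    (U : Y.Opens) [IsIso (g ∣_ U)] {y : Y} (hy : y ∈ U) : (g ⁻¹' {y}).Subsingleton := by
  intro a ha b hb
  have hinj : Function.Injective (g ∣_ U) := (g ∣_ U).homeomorph.injective
  have ha' : a ∈ g ⁻¹ᵁ U := by show g a ∈ U; rw [show g a = y from ha]; exact hy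
  have hb' : b ∈ g ⁻¹ᵁ U := by show g b ∈ U; rw [show g b = y from hb]; exact hy
  have key : (g ∣_ U) ⟨a, ha'⟩ = (g ∣_ U) ⟨b, hb'⟩ := by
    apply Subtype.ext
    rw [morphismRestrict_base_coe, morphismRestrict_base_coe]
    exact ha.trans hb.symm
  exact congrArg Subtype.val (hinj key)

/-! ## The comparison of generic points of `W'` and `W` -/

/-- **Compatibility of the generic points.** If the `K(W')`-algebra structure of `L` restricts
along `ρ^♯ : K(W) → K(W')` to the `K(W)`-algebra structure, then `Spec L → W'` composed with `ρ`
is `Spec L → W`. [folklore] -/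
theorem fromSpecExtension_comp_eq {W W' : Scheme.{0}} [IsIntegral W] [IsIntegral W']
    (ρ : W' ⟶ W) [IsDominant ρ] (L : Type) [Field L] [Algebra W.functionField L]
    [Algebra W'.functionField L]
    (hcompat : (algebraMap W'.functionField L).comp (RatFn.functionFieldMap ρ) =
      algebraMap W.functionField L) :
    fromSpecExtension W' L ≫ ρ = fromSpecExtension W L := by
  have h1 : W.presheaf.stalkSpecializes (RatFn.specializes_genericPoint ρ) ≫
      ρ.stalkMap (genericPoint W') = CommRingCat.ofHom (RatFn.functionFieldMap ρ) := rfl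
  rw [fromSpecExtension, fromSpecExtension, Category.assoc]
  change Spec.map (CommRingCat.ofHom (algebraMap W'.functionField L)) ≫
      W'.fromSpecStalk (genericPoint W') ≫ ρ =
    Spec.map (CommRingCat.ofHom (algebraMap W.functionField L)) ≫ W.fromSpecStalk (genericPoint W)
  rw [← Scheme.SpecMap_stalkMap_fromSpecStalk,
    ← Scheme.SpecMap_stalkSpecializes_fromSpecStalk (RatFn.specializes_genericPoint ρ),
    ← Spec.map_comp_assoc, ← Spec.map_comp_assoc, ← Category.assoc, h1,
    ← CommRingCat.ofHom_comp, hcompat]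

/-! ## The transport theorem -/

/-- **Resolvability of normalizations descends along proper dominant maps.** Let `W` be an
integral scheme locally of finite type over a field `k`, `L/K(W)` a finite extension, `W'` integral
with a `K(W')`-algebra structure on `L`, finite, and `ρ : W' → W` proper dominant such that
`K(W) → K(W') → L` is the structure map and the fibre of `ρ` over the generic point is the generic
point. If `W'^L` has a resolution then so has `W^L`: the comparison `φ : W'^L → W^L` is proper and
birational. Takes the function-field identification of normalizations as hypothesis `hK0`.
[folklore] -/
theorem hasResolution_normalizationIn_of_isProper
    (hK0 : ∀ (W : Scheme.{0}) [IsIntegral W] (L : Type) [Field L] [Algebra W.functionField L]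
      [FiniteDimensional W.functionField L], ∃ e : (normalizationIn W L).functionField ≃+* L,
        e.toRingHom.comp (RatFn.functionFieldMap (normalizationInι W L)) =
          algebraMap W.functionField L)
    {k : Type} [Field k] (W : Scheme.{0}) [IsIntegral W] (f : W ⟶ Spec (.of k))
    [LocallyOfFiniteType f] (L : Type) [Field L] [Algebra W.functionField L]
    [FiniteDimensional W.functionField L] (W' : Scheme.{0}) [IsIntegral W']
    [Algebra W'.functionField L] [FiniteDimensional W'.functionField L] (ρ : W' ⟶ W) [IsProper ρ]
    [IsDominant ρ]
    (hcompat : (algebraMap W'.functionField L).comp (RatFn.functionFieldMap ρ) =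
      algebraMap W.functionField L)
    (hfib : ∀ w' : W', ρ w' = genericPoint W → w' = genericPoint W')
    (hres : Scheme.HasResolution (normalizationIn W' L)) :
    Scheme.HasResolution (normalizationIn W L) := by
  haveI : IsFinite (normalizationInι W L) := isFinite_normalizationInι W L f
  haveI : IsFinite (normalizationInι W' L) := isFinite_normalizationInι W' L (ρ ≫ f)
  -- the factorization `Spec L → W^L ×_W W' → W'` of `Spec L → W'`
  have w : (fromSpecExtension W L).toNormalization ≫ normalizationInι W L =
      fromSpecExtension W' L ≫ ρ := by
    rw [fromSpecExtension_comp_eq ρ L hcompat]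
    exact (fromSpecExtension W L).toNormalization_fromNormalization
  obtain ⟨lift, hlift_fst, hlift_snd⟩ : ∃ lift : Spec (.of L) ⟶ pullback (normalizationInι W L) ρ,
      lift ≫ pullback.fst _ ρ = (fromSpecExtension W L).toNormalization ∧
        lift ≫ pullback.snd _ ρ = fromSpecExtension W' L :=
    ⟨pullback.lift _ _ w, pullback.lift_fst _ _ w, pullback.lift_snd _ _ w⟩
  -- the comparison map `φ : W'^L → W^L ×_W W' → W^L`
  obtain ⟨desc, hdesc_snd, hto_desc, hdesc_int⟩ :
      ∃ desc : normalizationIn W' L ⟶ pullback (normalizationInι W L) ρ,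
        desc ≫ pullback.snd _ ρ = normalizationInι W' L ∧
          (fromSpecExtension W' L).toNormalization ≫ desc = lift ∧ IsIntegralHom desc :=
    ⟨(fromSpecExtension W' L).normalizationDesc lift (pullback.snd _ ρ) hlift_snd.symm,
      (fromSpecExtension W' L).normalizationDesc_comp lift _ hlift_snd.symm,
      (fromSpecExtension W' L).toNormalization_normalizationDesc lift _ hlift_snd.symm,
      inferInstanceAs (IsIntegralHom ((fromSpecExtension W' L).normalizationDesc lift
        (pullback.snd (normalizationInι W L) ρ) hlift_snd.symm))⟩
  haveI := hdesc_int
  obtain ⟨φ, hφ⟩ : ∃ φ : normalizationIn W' L ⟶ normalizationIn W L,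
      φ = desc ≫ pullback.fst _ ρ := ⟨_, rfl⟩
  have hφι : φ ≫ normalizationInι W L = normalizationInι W' L ≫ ρ := by
    rw [hφ, Category.assoc, pullback.condition, ← Category.assoc, hdesc_snd]
  have hto_φ : (fromSpecExtension W' L).toNormalization ≫ φ =
      (fromSpecExtension W L).toNormalization := by
    have h := congrArg (fun t => t ≫ pullback.fst (normalizationInι W L) ρ) hto_desc
    simp only [Category.assoc, hlift_fst] at h
    rw [hφ]
    exact h
  -- `φ` is proper
  haveI : LocallyOfFiniteType desc := by
    have : LocallyOfFiniteType (desc ≫ pullback.snd (normalizationInι W L) ρ) := by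
      rw [hdesc_snd]; infer_instance
    exact locallyOfFiniteType_of_comp desc (pullback.snd _ ρ)
  haveI : IsFinite desc :=
    (IsFinite.iff_isIntegralHom_and_locallyOfFiniteType desc).mpr ⟨inferInstance, inferInstance⟩
  haveI : IsProper φ := by rw [hφ]; infer_instance
  -- `φ` is dominant
  haveI : IsDominant φ := by
    have : IsDominant ((fromSpecExtension W' L).toNormalization ≫ φ) := by
      rw [hto_φ]
      exact inferInstanceAs (IsDominant (fromSpecExtension W L).toNormalization)
    exact IsDominant.of_comp (fromSpecExtension W' L).toNormalization φ
  -- `φ` is an isomorphism on function fields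
  have hstalk : IsIso (φ.stalkMap (genericPoint (normalizationIn W' L))) := by
    obtain ⟨e, he⟩ := hK0 W L
    obtain ⟨e', he'⟩ := hK0 W' L
    apply BaseCase.isIso_stalkMap_genericPoint_of_bijective
    have hcomp : RatFn.functionFieldMap (φ ≫ normalizationInι W L) =
        (RatFn.functionFieldMap φ).comp (RatFn.functionFieldMap (normalizationInι W L)) :=
      RatFn.functionFieldMap_comp _ _
    have hcomp' : RatFn.functionFieldMap (φ ≫ normalizationInι W L) =
        (RatFn.functionFieldMap (normalizationInι W' L)).comp (RatFn.functionFieldMap ρ) := by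
      rw [FunctionFieldNormalizationIn.functionFieldMap_congr hφι]
      exact RatFn.functionFieldMap_comp _ _
    -- the `K(W)`-algebra endomorphism `ψ = e' ∘ φ^♯ ∘ e⁻¹` of `L`
    let ψ : L →+* L := e'.toRingHom.comp ((RatFn.functionFieldMap φ).comp e.symm.toRingHom)
    have h1 : e.symm.toRingHom.comp (algebraMap W.functionField L) =
        RatFn.functionFieldMap (normalizationInι W L) := by
      rw [← he]
      ext x
      simp
    have hψ : ψ.comp (algebraMap W.functionField L) = algebraMap W.functionField L := by
      calc ψ.comp (algebraMap _ L)
          = e'.toRingHom.comp ((RatFn.functionFieldMap φ).comp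
              (RatFn.functionFieldMap (normalizationInι W L))) := by
            rw [← h1]; rfl
        _ = e'.toRingHom.comp ((RatFn.functionFieldMap (normalizationInι W' L)).comp
              (RatFn.functionFieldMap ρ)) := by rw [← hcomp, hcomp']
        _ = (algebraMap W'.functionField L).comp (RatFn.functionFieldMap ρ) := by
            rw [← RingHom.comp_assoc, he']
        _ = algebraMap W.functionField L := hcompat
    have hbij := bijective_of_comp_algebraMap_eq ψ hψ
    have hφψ : RatFn.functionFieldMap φ = e'.symm.toRingHom.comp (ψ.comp e.toRingHom) := by
      ext x
      simp [ψ]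
    rw [hφψ]
    exact e'.symm.bijective.comp (hbij.comp e.bijective)
  -- the fibre of `φ` over the generic point is the generic point
  have hfibφ : (φ ⁻¹' {genericPoint (normalizationIn W L)}).Finite := by
    apply Set.Subsingleton.finite
    have key : ∀ n', φ n' = genericPoint (normalizationIn W L) →
        n' = genericPoint (normalizationIn W' L) := by
      intro n' hn'
      have h1 : ρ (normalizationInι W' L n') = genericPoint W := by
        rw [← Scheme.Hom.comp_apply, ← hφι, Scheme.Hom.comp_apply, hn']
        exact RatFn.genericPoint_eq_of_isDominant (normalizationInι W L)
      exact eq_genericPoint_of_isIntegralHom (normalizationInι W' L) (hfib _ h1)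
    exact fun a ha b hb => (key a ha).trans (key b hb).symm
  obtain ⟨V, hηV, hVfin⟩ :=
    exists_isFinite_morphismRestrict_of_finite_preimage_singleton φ _ hfibφ
  -- `φ` is an isomorphism over `V`
  have hN : ∀ y ∈ V, IsIntegrallyClosed ((normalizationIn W L).presheaf.stalk y) :=
    fun y _ => isIntegrallyClosed_stalk_normalizationIn W L y
  haveI := hVfin
  haveI : Nonempty V := ⟨⟨_, hηV⟩⟩
  haveI : IsDominant (φ ∣_ V) := IsZariskiLocalAtTarget.restrict ‹IsDominant φ› V
  haveI : Nonempty (φ ⁻¹ᵁ V) := nonempty_preimage_of_isDominant φ V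
  haveI : IsIntegral (φ ⁻¹ᵁ V) := isIntegral_of_isOpenImmersion (φ ⁻¹ᵁ V).ι
  haveI : IsIntegral V := isIntegral_of_isOpenImmersion V.ι
  have hstalkV := isIso_stalkMap_morphismRestrict_genericPoint φ hstalk V
  haveI : IsIso ((φ ∣_ V) ∣_ ⊤) := isIso_morphismRestrict_of_isIntegralHom_of_normal (φ ∣_ V)
    hstalkV ⊤ (fun v _ => isIntegrallyClosed_stalk_opens V hN v)
  have hiso : IsIso (φ ∣_ V) := isIso_of_isIso_morphismRestrict_top (φ ∣_ V)
  have hbir : IsBirational φ := by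
    refine ⟨V, V.isOpen.dense ⟨_, hηV⟩, ?_, hiso⟩
    obtain ⟨x⟩ := (inferInstance : Nonempty (φ ⁻¹ᵁ V))
    exact (φ ⁻¹ᵁ V).isOpen.dense ⟨x.1, x.2⟩
  exact Scheme.HasResolution.of_isBirational φ hbir hres

/-! ## Transport of algebra structures along a ring isomorphism of the base -/

/-- The function field of a scheme over a field of characteristic `p` has characteristic `p`.
[folklore] -/
theorem charP_functionField {p : ℕ} {k : Type} [Field k] [CharP k p] (Y : Scheme.{0})
    [IsIntegral Y] (f : Y ⟶ Spec (.of k)) : CharP Y.functionField p := by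
  haveI : Nonempty (⊤ : Y.Opens) := ⟨⟨genericPoint Y, trivial⟩⟩
  let φ : k →+* Y.functionField :=
    (Y.germToFunctionField ⊤).hom.comp ((f.appTop).hom.comp (Scheme.ΓSpecIso (.of k)).inv.hom)
  exact (φ.charP_iff_charP p).mp inferInstance

/-- Purely inseparable extensions of exponential characteristic `p` are stable under replacing
the base field by an isomorphic one (same image in `L`). [folklore] -/
theorem isPurelyInseparable_of_ringEquiv_base {p : ℕ} {K K' L : Type*} [Field K] [Field K']
    [Field L] [Algebra K L] [Algebra K' L] [ExpChar K p] [ExpChar K' p] (e : K' ≃+* K)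
    (he : (algebraMap K L).comp e.toRingHom = algebraMap K' L) [IsPurelyInseparable K L] :
    IsPurelyInseparable K' L := by
  rw [isPurelyInseparable_iff_pow_mem K' p]
  intro x
  obtain ⟨n, y, hy⟩ := (isPurelyInseparable_iff_pow_mem K p).mp ‹_› x
  refine ⟨n, e.symm y, ?_⟩
  rw [← he]
  simpa using hy

/-! ## The stub -/

/-- **Tower transport** (stub `stub_towerTransport` of the line `degree-p-tower`, statement
verbatim from the ledger registration). Fix `p`, `k`. Assume the function-field identification
(for all `W`, `L`) and the degree-`p` residue at `(p, k)`. Let `W` be an integral separated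
finite-type `k`-scheme, `L/K(W)` finite, `M` an intermediate field with `L/M` purely inseparable
of degree `p`, and suppose `W^M` has a resolution `ρ : W' → W^M`. Then `W^L` has a resolution:
`W'` is regular, integral, separated of finite type over `k` with `K(W') ≅ M` over `K(W)`, so `L`
is a `K(W')`-algebra purely inseparable of degree `p` and the residue resolves `W'^L`; the
comparison `W'^L → W^L` is proper birational (`hasResolution_normalizationIn_of_isProper`).
[cite: Temkin2013, Rem. 1.3.5 (ii)] -/
theorem stub_towerTransport : ∀ (p : ℕ) [Fact p.Prime] (k : Type) [Field k] [CharP k p], (∀ (W : Scheme.{0}) [IsIntegral W] (L : Type) [Field L] [Algebra W.functionField L] [FiniteDimensional W.functionField L], ∃ e : (normalizationIn W L).functionField ≃+* L, e.toRingHom.comp (RatFn.functionFieldMap (normalizationInι W L)) = algebraMap W.functionField L) → (∀ (W : Scheme.{0}) [IsIntegral W] (f : W ⟶ Spec (.of k)) (L : Type) [Field L] [Algebra W.functionField L], IsSeparated f → LocallyOfFiniteType f → QuasiCompact f → Scheme.IsRegular W → IsPurelyInseparable W.functionField L → Module.finrank W.functionField L = p → Scheme.HasResolution (normalizationIn W L))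 → ∀ (W : Scheme.{0}) [IsIntegral W] (f : W ⟶ Spec (.of k)) [IsSeparated f] [LocallyOfFiniteType f] [QuasiCompact f] (L : Type) [Field L] [Algebra W.functionField L] [FiniteDimensional W.functionField L] (M : IntermediateField W.functionField L), IsPurelyInseparable M L → Module.finrank M L = p → Scheme.HasResolution (normalizationIn W M) → Scheme.HasResolution (normalizationIn W L) := by
  intro p _ k _ _ hK0 hDegP W _ f _ _ _ L _ _ _ M hPI hM hMres
  have hp : p.Prime := Fact.out
  -- the resolution of `W^M` and its function field
  obtain ⟨W', ρ, hρ⟩ := hMres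
  haveI : IsProper ρ := hρ.isProper
  haveI : IsReduced W' := hρ.isRegular.isReduced
  haveI : IsIntegral W' := hρ.isBirational.isIntegral
  haveI : IsDominant ρ := hρ.isBirational.isDominant
  haveI : IsFinite (normalizationInι W M) := isFinite_normalizationInι W M f
  obtain ⟨eM, heM⟩ := hK0 W M
  have hbij : Function.Bijective (RatFn.functionFieldMap ρ) :=
    bijective_functionFieldMap_of_isIso ρ hρ.isBirational.isIso_stalkMap_genericPoint
  let e' : W'.functionField ≃+* M := (RingEquiv.ofBijective _ hbij).symm.trans eM
  have he' : e'.toRingHom.comp (RatFn.functionFieldMap ρ) = eM.toRingHom := by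
    refine RingHom.ext fun x => ?_
    simp only [e', RingEquiv.toRingHom_eq_coe, RingHom.coe_comp, RingHom.coe_coe,
      Function.comp_apply, RingEquiv.coe_trans]
    exact congrArg eM ((RingEquiv.ofBijective (RatFn.functionFieldMap ρ) hbij).symm_apply_apply x)
  -- `L` as a `K(W')`-algebra
  letI : Algebra W'.functionField L := ((algebraMap M L).comp e'.toRingHom).toAlgebra
  have halg : algebraMap W'.functionField L = (algebraMap M L).comp e'.toRingHom := rfl
  have hcompat : (algebraMap W'.functionField L).comp
      (RatFn.functionFieldMap (ρ ≫ normalizationInι W M)) = algebraMap W.functionField L := by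
    rw [RatFn.functionFieldMap_comp, halg, RingHom.comp_assoc,
      ← RingHom.comp_assoc (RatFn.functionFieldMap (normalizationInι W M)) (RatFn.functionFieldMap ρ)
        e'.toRingHom, he', heM]
    exact (IsScalarTower.algebraMap_eq W.functionField M L).symm
  -- degree and pure inseparability over `K(W')`
  have hdeg : Module.finrank W'.functionField L = p := by
    rw [← hM]
    exact Algebra.finrank_eq_of_equiv_equiv e' (RingEquiv.refl L) (by ext x; simp [halg])
  haveI : FiniteDimensional W'.functionField L :=
    Module.finite_of_finrank_pos (by rw [hdeg]; exact hp.pos)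
  haveI : CharP W.functionField p := charP_functionField W f
  haveI : CharP M p := charP_of_injective_algebraMap (algebraMap W.functionField M).injective p
  haveI : CharP W'.functionField p := (e'.toRingHom.charP_iff_charP p).mpr inferInstance
  haveI : ExpChar M p := ExpChar.prime hp
  haveI : ExpChar W'.functionField p := ExpChar.prime hp
  haveI : IsPurelyInseparable W'.functionField L :=
    isPurelyInseparable_of_ringEquiv_base (p := p) e' halg.symm
  -- the residue resolves `W'^L`
  have hres : Scheme.HasResolution (normalizationIn W' L) :=
    hDegP W' ((ρ ≫ normalizationInι W M) ≫ f) L inferInstance inferInstance inferInstance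
      hρ.isRegular inferInstance hdeg
  -- the fibre of `ρ ≫ ι_M` over the generic point of `W`
  have hfib : ∀ w' : W', (ρ ≫ normalizationInι W M) w' = genericPoint W →
      w' = genericPoint W' := by
    intro w' hw'
    rw [Scheme.Hom.comp_apply] at hw'
    have h1 : ρ w' = genericPoint (normalizationIn W M) :=
      eq_genericPoint_of_isIntegralHom (normalizationInι W M) hw'
    obtain ⟨U, hU, -, hUiso⟩ := hρ.isBirational
    haveI := hUiso
    have hηU : genericPoint (normalizationIn W M) ∈ U :=
      ((genericPoint_spec (normalizationIn W M)).mem_open_set_iff U.isOpen).mpr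
        (by simpa using hU.nonempty)
    exact subsingleton_preimage_of_isIso_morphismRestrict ρ U hηU h1
      (RatFn.genericPoint_eq_of_isDominant ρ)
  exact hasResolution_normalizationIn_of_isProper hK0 W f L W' (ρ ≫ normalizationInι W M)
    hcompat hfib hres

end Summit.ResolutionOfSingularities.ResolutionOfSingularities.Theorems.Picover.TowerTransport

end
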